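import Literature.Analysis.FluidPDE.Tao2016AveragedNS.SplitCascadeRescaledWindow
import Literature.Analysis.FluidPDE.Tao2016AveragedNS.SplitCascadeRescaledEnergy
import Literature.Analysis.FluidPDE.TaoCascadeZeroScalePhase
import HarnessLib

/-!
# The split Prop. 6.5, §6.7: zero-scale phase estimates (6.145)–(6.151) (port of `TaoCascadeZeroScalePhase`)

T. Tao, *Finite time blowup for an averaged three-dimensional Navier–Stokes equation*,
J. Amer. Math. Soc. 29 (2016), 601–674 = arXiv:1402.0290v3, §6.7 (6.145)–(6.151), (6.156), (6.160).
HONEST FRAMING: statements about the SPLIT cascade model system; nothing here proves the split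
Prop. 6.5 and nothing here concerns the true Navier–Stokes equations.

Split counterpart of `TaoCascadeZeroScalePhase.lean` (same lemma names under `RescaledSplitHypotheses`):
the hypotheses are carried with error constant `C₁/2` and every lemma takes the window certificate
`hw : AsymWindow ε₀ K ε C₁ n₀ W T ζ` (`SplitCascadeRescaledWindow.lean`), under which the mode equations
have the tree's exact right-hand sides, so statements and proofs are the tree's (the abstract
comparison lemmas of `TaoCascadeZeroScale.lean` are reused); the only changed statement is
`neg_one_energy_le` ((6.151)), whose rate carries the absorbed two-way outflow correction
`+(C₁/2)(1+ε₀)^{-n₀/2}` and which assumes `Ẽ₀ ≤ 1` on the window.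

## References

* T. Tao, J. Amer. Math. Soc. 29 (2016), 601–674 = arXiv:1402.0290v3, §6.7 (6.145)–(6.151).
  [`Tao2016AveragedNS`]
-/

noncomputable section

open Set MeasureTheory intervalIntegral Filter Topology

namespace Literature.Analysis.FluidPDE

namespace Tao2016AveragedNS

open TaoCascade Literature.Analysis.ODE

section ZeroPhase

variable {γ ε₀ K ε C₁ C₂ C₃ : ℝ} {n₀ N : ℤ} {ηp : ℤ → ℝ} {βp : ℕ → ℝ} {τ : ℤ → ℝ}
  {Xr : Fin 4 → ℤ → ℝ → ℝ} {W : Fin 3 → ℤ → ℝ → ℝ} {Er : ℤ → ℝ → ℝ} {T ζ : ℝ}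

/-- Modes of a scale whose energy is `≤ 1` are bounded by `√2`. [cite: Tao2016AveragedNS, §6.7 (6.145)] -/
theorem RescaledSplitHypotheses.abs_le_sqrt_two
    (h : RescaledSplitHypotheses γ ε₀ K ε C₁ C₂ C₃ n₀ N ηp βp τ Xr W Er) (i : Fin 4) (k : ℤ) {t : ℝ}
    (ht : τ (n₀ - N) ≤ t) (hE : Er k t ≤ 1) : |Xr i k t| ≤ Real.sqrt 2 :=
  (h.abs_le_sqrt_energy i k ht).trans (Real.sqrt_le_sqrt (by linarith))

/-- **(6.146): almost conservation of `a₀²+b₀²+c₀²+d₀²+a₁²` on a bootstrap interval.** On `[0, T]`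
with `Ẽ₀, Ẽ₁ ≤ 1`, `Ẽ₋₁ ≤ E₋` and `|b₁| ≤ B_b`, `|c₁| ≤ B_c`, `|d₁| ≤ B_d`:
`|S(t) - S(0)| ≤ L·t`, `S = a₀²+b₀²+c₀²+d₀²+a₁²`, with
`L = 2√2(η₁ + 3η₂ + η₃) + 4√2(ε + ε²e^{-K^{10}}) + 4ν`, where
`η₁ = 2ε + 2ε²e^{-K^{10}} + 2KE₋ + C₁δ`, `η₂ = C₁δ`, `ν = (1+ε₀)^{5/2}(εB_b + ε²e^{-K^{10}}B_c)`,
`η₃ = (1+ε₀)^{5/2}ε⁻²B_cB_d + C₁(1+ε₀)^{2-n₀/2}`, `δ = (1+ε₀)^{-n₀/2}`.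
[cite: Tao2016AveragedNS, §6.7 (6.146)] -/
theorem RescaledSplitHypotheses.zero_energy_identity
    (h : RescaledSplitHypotheses γ ε₀ K ε (C₁ / 2) C₂ C₃ n₀ N ηp βp τ Xr W Er)
    (hw : AsymWindow ε₀ K ε C₁ n₀ W T ζ) (hε1 : ε ≤ 1) (hK1 : 1 ≤ K) (hε₀1 : ε₀ < 1) (hε : 0 < ε) (hC₁ : 0 ≤ C₁)
    (hε₀ : 0 < ε₀) {Em Bb Bc Bd : ℝ} (hτ0 : τ (n₀ - N) ≤ 0)
    (hreg : ∀ t ∈ Icc 0 T, Er 0 t ≤ 1 ∧ Er 1 t ≤ 1 ∧ Er (-1) t ≤ Em)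
    (hsec : ∀ t ∈ Icc 0 T, |Xr 1 1 t| ≤ Bb ∧ |Xr 2 1 t| ≤ Bc ∧ |Xr 3 1 t| ≤ Bd)
    {t : ℝ} (ht : t ∈ Icc 0 T) :
    |(Xr 0 0 t ^ 2 + Xr 1 0 t ^ 2 + Xr 2 0 t ^ 2 + Xr 3 0 t ^ 2 + Xr 0 1 t ^ 2) -
        (Xr 0 0 0 ^ 2 + Xr 1 0 0 ^ 2 + Xr 2 0 0 ^ 2 + Xr 3 0 0 ^ 2 + Xr 0 1 0 ^ 2)| ≤
      (2 * Real.sqrt 2 *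
          ((2 * ε + 2 * ε ^ 2 * Real.exp (-K ^ 10) + 2 * K * Em + C₁ * (1 + ε₀) ^ (-((n₀ : ℝ) / 2))) +
            3 * (C₁ * (1 + ε₀) ^ (-((n₀ : ℝ) / 2))) +
            ((1 + ε₀) ^ ((5 : ℝ) / 2) * (ε ^ 2)⁻¹ * Bc * Bd + C₁ * (1 + ε₀) ^ (2 - (n₀ : ℝ) / 2))) +
        2 * Real.sqrt 2 ^ 3 * (|ε| + |ε ^ 2 * Real.exp (-K ^ 10)|) +
        2 * ((1 + ε₀) ^ ((5 : ℝ) / 2) * (ε * Bb + ε ^ 2 * Real.exp (-K ^ 10) * Bc)) * Real.sqrt 2 ^ 2) *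
      (t - 0) := by
  have hε₀' : -1 < ε₀ := by linarith
  have hBb : 0 ≤ Bb := (abs_nonneg _).trans (hsec 0 ⟨le_rfl, ht.1.trans ht.2⟩).1
  have hBc : 0 ≤ Bc := (abs_nonneg _).trans (hsec 0 ⟨le_rfl, ht.1.trans ht.2⟩).2.1
  have hν : 0 ≤ (1 + ε₀) ^ ((5 : ℝ) / 2) * (ε * Bb + ε ^ 2 * Real.exp (-K ^ 10) * Bc) := by
    have : 0 ≤ (1 + ε₀) ^ ((5 : ℝ) / 2) := Real.rpow_nonneg (by linarith) _
    positivity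
  refine abs_energy_sub_le (h.contDiffOn_Y 0 0) (h.contDiffOn_Y 1 0) (h.contDiffOn_Y 2 0)
    (h.contDiffOn_Y 3 0) (h.contDiffOn_Y 0 1) hτ0 hν (t₂ := T)
    (fun s hs => h.eq_a_zero' hw hτ0 hε hε1 hK1 hC₁ hε₀ hs (hreg s hs).1 (hreg s hs).2.2)
    (fun s hs => h.eq_b_zero' hw hτ0 hε hε1 hK1 hC₁ hε₀ hs (hreg s hs).1)
    (fun s hs => h.eq_c_zero' hw hτ0 hε hε1 hK1 hC₁ hε₀ hs (hreg s hs).1)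
    (fun s hs => h.eq_d_zero' hw hτ0 hε hε1 hK1 hC₁ hε₀ hs (hreg s hs).1)
    (fun s hs => h.eq_a_one' hw hτ0 hε hε1 hK1 hC₁ hε₀ hε₀1 hs (hreg s hs).2.1 (hsec s hs).1
      (hsec s hs).2.1 (hsec s hs).2.2)
    (fun s hs => h.abs_le_sqrt_two 0 0 (hτ0.trans hs.1) (hreg s hs).1)
    (fun s hs => h.abs_le_sqrt_two 1 0 (hτ0.trans hs.1) (hreg s hs).1)
    (fun s hs => h.abs_le_sqrt_two 2 0 (hτ0.trans hs.1) (hreg s hs).1)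
    (fun s hs => h.abs_le_sqrt_two 3 0 (hτ0.trans hs.1) (hreg s hs).1)
    (fun s hs => h.abs_le_sqrt_two 0 1 (hτ0.trans hs.1) (hreg s hs).2.1) ht

/-- **(6.147): linear growth of `√(b₀²+c₀²)`.** On `[0, T]` with `Ẽ₀ ≤ 1` and `a₀² ≤ A²` there
(`ε ≤ 1`): `√(b₀²+c₀²)(t) ≤ √(b₀²+c₀²)(0) + (√2 ε A² + √2 C₁(1+ε₀)^{-n₀/2}) t`.
[cite: Tao2016AveragedNS, §6.7 (6.147)] -/
theorem RescaledSplitHypotheses.zero_bc_growth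
    (h : RescaledSplitHypotheses γ ε₀ K ε (C₁ / 2) C₂ C₃ n₀ N ηp βp τ Xr W Er)
    (hw : AsymWindow ε₀ K ε C₁ n₀ W T ζ) (hK1 : 1 ≤ K) (hε : 0 < ε) (hε1 : ε ≤ 1) (hC₁ : 0 ≤ C₁)
    (hε₀ : 0 < ε₀) {A : ℝ} (hτ0 : τ (n₀ - N) ≤ 0)
    (hreg : ∀ t ∈ Icc 0 T, Er 0 t ≤ 1) (hA : ∀ t ∈ Icc 0 T, Xr 0 0 t ^ 2 ≤ A ^ 2)
    {t : ℝ} (ht : t ∈ Icc 0 T) :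
    Real.sqrt (Xr 1 0 t ^ 2 + Xr 2 0 t ^ 2) ≤
      Real.sqrt (Xr 1 0 0 ^ 2 + Xr 2 0 0 ^ 2) +
        (Real.sqrt 2 * ε * A ^ 2 + Real.sqrt 2 * (C₁ * (1 + ε₀) ^ (-((n₀ : ℝ) / 2)))) * (t - 0) := by
  have hε₀' : -1 < ε₀ := by linarith
  have hlam : ε ^ 2 * Real.exp (-K ^ 10) ≤ ε := by
    have h1 : Real.exp (-K ^ 10) ≤ 1 := by
      rw [Real.exp_le_one_iff]; have := pow_two_nonneg (K ^ 5); nlinarith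
    calc ε ^ 2 * Real.exp (-K ^ 10) ≤ ε ^ 2 * 1 := mul_le_mul_of_nonneg_left h1 (sq_nonneg _)
      _ = ε * ε := by ring
      _ ≤ ε * 1 := mul_le_mul_of_nonneg_left hε1 hε.le
      _ = ε := mul_one _
  exact sqrt_sq_add_sq_le (h.contDiffOn_Y 1 0) (h.contDiffOn_Y 2 0) hτ0 hε.le (by positivity) hlam
    (mul_nonneg hC₁ (Real.rpow_nonneg (by linarith) _)) hA (t₂ := T)
    (fun s hs => h.eq_b_zero' hw hτ0 hε hε1 hK1 hC₁ hε₀ hs (hreg s hs))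
    (fun s hs => h.eq_c_zero' hw hτ0 hε hε1 hK1 hC₁ hε₀ hs (hreg s hs)) ht

/-- **(6.148): Grönwall for `c₀`.** On `[0, T]` with `Ẽ₀ ≤ 1`:
`|c₀(t)| ≤ exp(∫₀ᵗ|ε⁻¹K^{10}b₀|)(|c₀(0)| + ∫₀ᵗ(ε²e^{-K^{10}}a₀² + C₁(1+ε₀)^{-n₀/2}))`.
[cite: Tao2016AveragedNS, §6.7 (6.148)] -/
theorem RescaledSplitHypotheses.zero_c_abs_le
    (h : RescaledSplitHypotheses γ ε₀ K ε (C₁ / 2) C₂ C₃ n₀ N ηp βp τ Xr W Er)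
    (hw : AsymWindow ε₀ K ε C₁ n₀ W T ζ) (hε : 0 < ε) (hε1 : ε ≤ 1) (hK1 : 1 ≤ K) (hC₁ : 0 ≤ C₁) (hε₀ : 0 < ε₀)
    (hτ0 : τ (n₀ - N) ≤ 0) (hreg : ∀ t ∈ Icc 0 T, Er 0 t ≤ 1) {t : ℝ} (ht : t ∈ Icc 0 T) :
    |Xr 2 0 t| ≤ Real.exp (∫ s in (0 : ℝ)..t, |ε⁻¹ * K ^ 10 * Xr 1 0 s|) *
      (|Xr 2 0 0| + ∫ s in (0 : ℝ)..t,
        (|ε ^ 2 * Real.exp (-K ^ 10)| * Xr 0 0 s ^ 2 + C₁ * (1 + ε₀) ^ (-((n₀ : ℝ) / 2)))) := by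
  have hε₀' : -1 < ε₀ := by linarith
  exact abs_c_le_exp_integral (h.contDiffOn_Y 2 0) (h.continuousOn_X 0 0 hτ0) (h.continuousOn_X 1 0 hτ0)
    hτ0 (mul_nonneg hC₁ (Real.rpow_nonneg (by linarith) _)) (t₂ := T)
    (fun s hs => h.eq_c_zero' hw hτ0 hε hε1 hK1 hC₁ hε₀ hs (hreg s hs)) ht

/-- **(6.149)–(6.150): Grönwall for `√(d₀²+a₁²)`.** On `[0, T]` with the regime bounds:
`√(d₀²+a₁²)(t) ≤ e^{νt}(√(d₀²+a₁²)(0) + ∫₀ᵗ(ε⁻²√2|c₀| + η₂ + η₃))` with `ν, η₂, η₃` as in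
`zero_energy_identity`. [cite: Tao2016AveragedNS, §6.7 (6.149)–(6.150)] -/
theorem RescaledSplitHypotheses.zero_da_sqrt_le
    (h : RescaledSplitHypotheses γ ε₀ K ε (C₁ / 2) C₂ C₃ n₀ N ηp βp τ Xr W Er)
    (hw : AsymWindow ε₀ K ε C₁ n₀ W T ζ) (hε1 : ε ≤ 1) (hK1 : 1 ≤ K) (hε₀1 : ε₀ < 1) (hε : 0 < ε) (hC₁ : 0 ≤ C₁)
    (hε₀ : 0 < ε₀) {Bb Bc Bd : ℝ} (hτ0 : τ (n₀ - N) ≤ 0)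
    (hreg : ∀ t ∈ Icc 0 T, Er 0 t ≤ 1 ∧ Er 1 t ≤ 1)
    (hsec : ∀ t ∈ Icc 0 T, |Xr 1 1 t| ≤ Bb ∧ |Xr 2 1 t| ≤ Bc ∧ |Xr 3 1 t| ≤ Bd)
    {t : ℝ} (ht : t ∈ Icc 0 T) :
    Real.sqrt (Xr 3 0 t ^ 2 + Xr 0 1 t ^ 2) ≤
      Real.exp ((1 + ε₀) ^ ((5 : ℝ) / 2) * (ε * Bb + ε ^ 2 * Real.exp (-K ^ 10) * Bc) * (t - 0)) *
        (Real.sqrt (Xr 3 0 0 ^ 2 + Xr 0 1 0 ^ 2) + ∫ s in (0 : ℝ)..t,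
          ((ε ^ 2)⁻¹ * Real.sqrt 2 * |Xr 2 0 s| + C₁ * (1 + ε₀) ^ (-((n₀ : ℝ) / 2)) +
            ((1 + ε₀) ^ ((5 : ℝ) / 2) * (ε ^ 2)⁻¹ * Bc * Bd + C₁ * (1 + ε₀) ^ (2 - (n₀ : ℝ) / 2)))) := by
  have hε₀' : -1 < ε₀ := by linarith
  have hq : 0 ≤ (1 + ε₀) ^ ((5 : ℝ) / 2) := Real.rpow_nonneg (by linarith) _
  have hBb : 0 ≤ Bb := (abs_nonneg _).trans (hsec 0 ⟨le_rfl, ht.1.trans ht.2⟩).1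
  have hBc : 0 ≤ Bc := (abs_nonneg _).trans (hsec 0 ⟨le_rfl, ht.1.trans ht.2⟩).2.1
  have hBd : 0 ≤ Bd := (abs_nonneg _).trans (hsec 0 ⟨le_rfl, ht.1.trans ht.2⟩).2.2
  have hη₃ : 0 ≤ (1 + ε₀) ^ ((5 : ℝ) / 2) * (ε ^ 2)⁻¹ * Bc * Bd + C₁ * (1 + ε₀) ^ (2 - (n₀ : ℝ) / 2) := by
    have : 0 ≤ C₁ * (1 + ε₀) ^ (2 - (n₀ : ℝ) / 2) := mul_nonneg hC₁ (Real.rpow_nonneg (by linarith) _)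
    positivity
  exact sqrt_d_sq_add_a_sq_le (h.contDiffOn_Y 3 0) (h.contDiffOn_Y 0 1) (h.continuousOn_X 2 0 hτ0)
    hτ0 (by positivity) (by positivity) (mul_nonneg hC₁ (Real.rpow_nonneg (by linarith) _)) hη₃
    (t₂ := T) (fun s hs => h.abs_le_sqrt_two 0 0 (hτ0.trans hs.1) (hreg s hs).1)
    (fun s hs => h.eq_d_zero' hw hτ0 hε hε1 hK1 hC₁ hε₀ hs (hreg s hs).1)
    (fun s hs => h.eq_a_one' hw hτ0 hε hε1 hK1 hC₁ hε₀ hε₀1 hs (hreg s hs).2 (hsec s hs).1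
      (hsec s hs).2.1 (hsec s hs).2.2) ht

/-- **`a₀` barely moves while `c₀, d₀` are small** ((6.150): "`|∂ₜa₀| ≲ …`, which among other
things implies that `a₀(t) ≥ 0`"; (6.156): "`∂ₜa₀ = O(K⁻⁹)` … `a₀(t) = 1 + O(K⁻⁹)`"): on `[0, T]`
with `Ẽ₀ ≤ 1`, `Ẽ₋₁ ≤ E₋`, `|c₀| ≤ C_max`, `|d₀| ≤ D_max`:
`|a₀(t) - a₀(0)| ≤ (ε⁻² C_max D_max + 2ε + 2ε²e^{-K^{10}} + 2KE₋ + C₁(1+ε₀)^{-n₀/2}) t`.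
[cite: Tao2016AveragedNS, §6.7 (6.150), (6.156)] -/
theorem RescaledSplitHypotheses.zero_a_sub_le
    (h : RescaledSplitHypotheses γ ε₀ K ε (C₁ / 2) C₂ C₃ n₀ N ηp βp τ Xr W Er)
    (hw : AsymWindow ε₀ K ε C₁ n₀ W T ζ) (hε1 : ε ≤ 1) (hK1 : 1 ≤ K) (hε : 0 < ε) (hC₁ : 0 ≤ C₁)
    (hε₀ : 0 < ε₀) {Em Cmax Dmax : ℝ} (hτ0 : τ (n₀ - N) ≤ 0)
    (hreg : ∀ t ∈ Icc 0 T, Er 0 t ≤ 1 ∧ Er (-1) t ≤ Em)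
    (hcd : ∀ t ∈ Icc 0 T, |Xr 2 0 t| ≤ Cmax ∧ |Xr 3 0 t| ≤ Dmax) {t : ℝ} (ht : t ∈ Icc 0 T) :
    |Xr 0 0 t - Xr 0 0 0| ≤
      ((ε ^ 2)⁻¹ * Cmax * Dmax +
        (2 * ε + 2 * ε ^ 2 * Real.exp (-K ^ 10) + 2 * K * Em + C₁ * (1 + ε₀) ^ (-((n₀ : ℝ) / 2)))) *
        (t - 0) := by
  have hε₀' : -1 < ε₀ := by linarith
  have hCmax : 0 ≤ Cmax := (abs_nonneg _).trans (hcd 0 ⟨le_rfl, ht.1.trans ht.2⟩).1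
  have key := norm_image_sub_le_of_norm_deriv_right_le_segment (h.continuousOn_X 0 0 hτ0 (b := T))
    (fun s hs => h.hasDeriv_X 0 0 (hτ0.trans hs.1))
    (C := (ε ^ 2)⁻¹ * Cmax * Dmax +
      (2 * ε + 2 * ε ^ 2 * Real.exp (-K ^ 10) + 2 * K * Em + C₁ * (1 + ε₀) ^ (-((n₀ : ℝ) / 2))))
    ?_ t ht
  · simpa [Real.norm_eq_abs] using key
  · intro s hs
    have hs' : s ∈ Icc 0 T := Ico_subset_Icc_self hs
    have he := h.eq_a_zero' hw hτ0 hε hε1 hK1 hC₁ hε₀ hs' (hreg s hs').1 (hreg s hs').2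
    have hprod : |(ε ^ 2)⁻¹ * Xr 2 0 s * Xr 3 0 s| ≤ (ε ^ 2)⁻¹ * Cmax * Dmax := by
      rw [abs_mul, abs_mul, abs_of_pos (by positivity : (0 : ℝ) < (ε ^ 2)⁻¹)]
      have := mul_le_mul (hcd s hs').1 (hcd s hs').2 (abs_nonneg _) hCmax
      calc (ε ^ 2)⁻¹ * |Xr 2 0 s| * |Xr 3 0 s| = (ε ^ 2)⁻¹ * (|Xr 2 0 s| * |Xr 3 0 s|) := by ring
        _ ≤ (ε ^ 2)⁻¹ * (Cmax * Dmax) := mul_le_mul_of_nonneg_left this (by positivity)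
        _ = _ := by ring
    rw [Real.norm_eq_abs]
    have := abs_sub (derivWithin (Xr 0 0) (Ici (τ (n₀ - N))) s +
      (ε ^ 2)⁻¹ * Xr 2 0 s * Xr 3 0 s) ((ε ^ 2)⁻¹ * Xr 2 0 s * Xr 3 0 s)
    simp only [add_sub_cancel_right] at this
    linarith

/-- **(6.151): `Ẽ₋₁` varies slowly while `a₀ ≥ 0`.** On `[0, T]` with `Ẽ₋₁ ≤ E₁`, `Ẽ₋₂ ≤ E₂`
and `a₀ ≥ 0`, `Ẽ₀ ≤ 1` there: `Ẽ₋₁(t) ≤ Ẽ₋₁(0) + (2K(1+ε₀)^{-5/2}E₂√(2E₁) + (C₁/2)(1+ε₀)^{-n₀/2})·t`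
(the split two-way outflow correction absorbed) ("`∂ₜẼ₋₁ ≤ O(K^{-14})` on this
interval"). [cite: Tao2016AveragedNS, §6.7 (6.151)] -/
theorem RescaledSplitHypotheses.neg_one_energy_le
    (h : RescaledSplitHypotheses γ ε₀ K ε (C₁ / 2) C₂ C₃ n₀ N ηp βp τ Xr W Er)
    (hw : AsymWindow ε₀ K ε C₁ n₀ W T ζ) (hε : 0 < ε) (hε1 : ε ≤ 1) (hK1 : 1 ≤ K) (hε₀ : 0 < ε₀)
    {E₁ E₂ : ℝ} (hτ0 : τ (n₀ - N) ≤ 0)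
    (hE0 : ∀ t ∈ Icc 0 T, Er 0 t ≤ 1)
    (hreg : ∀ t ∈ Icc 0 T, Er (-1) t ≤ E₁ ∧ Er (-2) t ≤ E₂) (ha : ∀ t ∈ Icc 0 T, 0 ≤ Xr 0 0 t)
    {t : ℝ} (ht : t ∈ Icc 0 T) :
    Er (-1) t ≤ Er (-1) 0 +
      (2 * K * (1 + ε₀) ^ (-((5 : ℝ) / 2)) * E₂ * Real.sqrt (2 * E₁) + C₁ / 2 * (1 + ε₀) ^ (-(n₀ : ℝ) / 2)) *
        (t - 0) := by
  have hε₀' : -1 < ε₀ := by linarith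
  have hb := le_add_integral_of_deriv_right_le (h.continuousOn_E (-1) hτ0)
    (fun s hs => h.hasDeriv_E (-1) (hτ0.trans hs.1))
    (A := fun _ => 2 * K * (1 + ε₀) ^ (-((5 : ℝ) / 2)) * E₂ * Real.sqrt (2 * E₁) +
      C₁ / 2 * (1 + ε₀) ^ (-(n₀ : ℝ) / 2))
    continuousOn_const ?_ ht (b := T)
  · have hI : ∫ s in (0 : ℝ)..t,
        (fun _ : ℝ => 2 * K * (1 + ε₀) ^ (-((5 : ℝ) / 2)) * E₂ * Real.sqrt (2 * E₁) +
          C₁ / 2 * (1 + ε₀) ^ (-(n₀ : ℝ) / 2)) s =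
        (2 * K * (1 + ε₀) ^ (-((5 : ℝ) / 2)) * E₂ * Real.sqrt (2 * E₁) + C₁ / 2 * (1 + ε₀) ^ (-(n₀ : ℝ) / 2)) *
          (t - 0) := by
      simp only [intervalIntegral.integral_const, smul_eq_mul]; ring
    rw [hI] at hb; exact hb
  · intro s hs
    have hs' : s ∈ Icc 0 T := Ico_subset_Icc_self hs
    have he := h.energy_neg_one_deriv_le' hw hτ0 hε hε1 hK1 hε₀ hs' (hE0 s hs') (hreg s hs').1 (hreg s hs').2
    have hdrain : 0 ≤ K * Xr 3 (-1) s ^ 2 * Xr 0 0 s := by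
      have := ha s hs'; have hK : (0:ℝ) ≤ K := by linarith
      positivity
    show derivWithin (Er (-1)) (Ici (τ (n₀ - N))) s ≤ _
    linarith

/-- **The forward-flow quantity `∫₀ᵗ a₁²` is small while `|a₁| ≤ A₁`**: `∫₀ᵗ a₁² ≤ A₁² t`
(for (6.151)/(6.160): "`∫₀^{t_c} a₁² ≲ K^{-10}`"). [cite: Tao2016AveragedNS, §6.7 (6.160)] -/
theorem RescaledSplitHypotheses.integral_a_one_sq_le
    (h : RescaledSplitHypotheses γ ε₀ K ε C₁ C₂ C₃ n₀ N ηp βp τ Xr W Er) {A₁ : ℝ} (hτ0 : τ (n₀ - N) ≤ 0)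
    (ha : ∀ t ∈ Icc 0 T, |Xr 0 1 t| ≤ A₁) {t : ℝ} (ht : t ∈ Icc 0 T) :
    ∫ s in (0 : ℝ)..t, Xr 0 1 s ^ 2 ≤ A₁ ^ 2 * t := by
  have hc : ContinuousOn (fun s => Xr 0 1 s ^ 2) (Icc 0 t) := (h.continuousOn_X 0 1 hτ0).pow 2
  have h1 : ∫ s in (0 : ℝ)..t, Xr 0 1 s ^ 2 ≤ ∫ s in (0 : ℝ)..t, A₁ ^ 2 := by
    apply integral_mono_on ht.1 (hc.intervalIntegrable_of_Icc ht.1) (continuous_const.intervalIntegrable _ _)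
    intro s hs
    have := ha s ⟨hs.1, hs.2.trans ht.2⟩
    rw [← sq_abs]
    exact pow_le_pow_left₀ (abs_nonneg _) this 2
  have h2 : ∫ s in (0 : ℝ)..t, A₁ ^ 2 = A₁ ^ 2 * t := by
    simp only [intervalIntegral.integral_const, smul_eq_mul]; ring
  linarith

end ZeroPhase

end Tao2016AveragedNS

end Literature.Analysis.FluidPDE
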